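import Literature.MathematicalPhysics.QuantumLattice.IsotropicMaster
import Literature.MathematicalPhysics.QuantumLattice.SectorSymbolMasterSmooth
import HarnessLib

/-!
# The isotropic master symbol is smooth; `h`-uniform derivative bounds of the rescaled isotropic symbols
(Benfatto–Giuliani–Mastropietro 2006, Lemma 2.3: the `h`-uniform estimates, part 2)

Topic `Literature/MathematicalPhysics/QuantumLattice`; the isotropic companion of
`SectorSymbolMasterSmooth.lean`, for `IsotropicMaster.lean`
(`rescaledIsoSymbol e₀ n ω̄ = 4ⁿ · Φ̄(θ̄_{n,ω̄}, ·; 4^{-n})`). PROVED here: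

* `contDiff_isoMasterLift` — the isotropic master symbol is jointly `C^∞` in `((θ₀, r), t)`;
* `rescaledIsoSymbol_eq_smul_isoMasterLift`;
* the **support box** `abs_le_of_rescaledIsoSymbol_ne_zero`: `|t₀| ≤ e₀`, `|t₁| ≤ C̄₁`, `|t₂| ≤ C̄₂`
  INDEPENDENT of `n, ω̄` (the isotropic box `|k'₁|, |k'₂| ≤ C 4^{-n}` read in the chart
  `k' = 4^{-n}(t₁ n + t₂ τ)`);
* **`exists_norm_iteratedFDeriv_rescaledIsoSymbol_le`** — `‖D^m(rescaledIsoSymbol e₀ n ω̄)(t)‖ ≤ 4ⁿ B_m`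
  for ALL `n`, all `0 ≤ ω̄ < 2·4ⁿ` and all `t`, by compactness.

Everything is PROVED; the definitions are `isoMasterLift` and the two constants.

## Sources

* G. Benfatto, A. Giuliani, V. Mastropietro, Ann. Henri Poincaré 7 (2006) 809–898, §2.5
  Lemma 2.3 (2.60) (arXiv:cond-mat/0507686 p. 12). [BenfattoGiulianiMastropietro2006]
-/

noncomputable section

open Real Set Complex Function Metric
open scoped Topology ComplexConjugate
open Literature.Analysis.Calculus Literature.Analysis.SpecialFunctions

namespace Literature.MathematicalPhysics.QuantumLattice

/-! ### Joint smoothness of the isotropic master symbol -/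

/-- The isotropic master symbol as a function of `((θ₀, r), t) ∈ ℝ² × ℝ³`. [cite: BenfattoGiulianiMastropietro2006, §2.5 Lemma 2.3] -/
def isoMasterLift (μ e₀ : ℝ) (q : (ℝ × ℝ) × MomSpace) : ℂ :=
  isoMasterSymbol μ e₀ (q.1.1, q.2 1, q.2 2) (q.2 0) q.1.2

section Smooth

variable {μ : ℝ} (hμ₁ : -4 < μ) (hμ₂ : μ < -2 - Real.sqrt 2)
include hμ₁ hμ₂

/-- **The isotropic master symbol is jointly smooth.** [cite: BenfattoGiulianiMastropietro2006, §2.5 Lemma 2.3] -/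
theorem contDiff_isoMasterLift {e₀ : ℝ} (he : 0 < e₀) : ContDiff ℝ ((⊤ : ℕ∞) : WithTop ℕ∞) (isoMasterLift μ e₀) := by
  have hθ : ContDiff ℝ ((⊤ : ℕ∞) : WithTop ℕ∞) fun q : (ℝ × ℝ) × MomSpace => q.1.1 := contDiff_fst.comp contDiff_fst
  have hs : ContDiff ℝ ((⊤ : ℕ∞) : WithTop ℕ∞) fun q : (ℝ × ℝ) × MomSpace => q.1.2 := contDiff_snd.comp contDiff_fst
  have h0 := contDiff_momSpace_coord 0 (n := ((⊤ : ℕ∞) : WithTop ℕ∞))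
  have h1 := contDiff_momSpace_coord 1 (n := ((⊤ : ℕ∞) : WithTop ℕ∞))
  have h2 := contDiff_momSpace_coord 2 (n := ((⊤ : ℕ∞) : WithTop ℕ∞))
  have hx : ContDiff ℝ ((⊤ : ℕ∞) : WithTop ℕ∞) fun q : (ℝ × ℝ) × MomSpace => ((q.1.1, q.2 1, q.2 2) : ℝ × ℝ × ℝ) :=
    hθ.prodMk (h1.prodMk h2)
  have hxs : ContDiff ℝ ((⊤ : ℕ∞) : WithTop ℕ∞)
      fun q : (ℝ × ℝ) × MomSpace => (((q.1.1, q.2 1, q.2 2), q.1.2) : (ℝ × ℝ × ℝ) × ℝ) :=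
    hx.prodMk hs
  -- the rescaled dispersion and denominator
  have hE : ContDiff ℝ ((⊤ : ℕ∞) : WithTop ℕ∞)
      fun q : (ℝ × ℝ) × MomSpace => isoRescaledDispersion μ ((q.1.1, q.2 1, q.2 2), q.1.2) :=
    (contDiff_isoRescaledDispersion hμ₁ hμ₂).comp hxs
  have hD : ContDiff ℝ ((⊤ : ℕ∞) : WithTop ℕ∞)
      fun q : (ℝ × ℝ) × MomSpace => isoRescaledDenom μ (q.1.1, q.2 1, q.2 2) (q.2 0) q.1.2 := by
    unfold isoRescaledDenom
    exact (contDiff_const.mul (Complex.ofRealCLM.contDiff.comp h0)).neg.add (Complex.ofRealCLM.contDiff.comp hE)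
  -- the shell factor `G(√(t₀² + Ẽ²))`
  have hG : ContDiff ℝ ((⊤ : ℕ∞) : WithTop ℕ∞) fun q : (ℝ × ℝ) × MomSpace =>
      gnShell 4 e₀ 0 (Real.sqrt (q.2 0 ^ 2 + isoRescaledDispersion μ ((q.1.1, q.2 1, q.2 2), q.1.2) ^ 2)) := by
    have hsq : ContDiff ℝ ((⊤ : ℕ∞) : WithTop ℕ∞) fun r : ℝ => gnShell 4 e₀ 0 (Real.sqrt r) :=
      contDiff_comp_sqrt_of_eq_zero (contDiff_gnShell 4 e₀ 0) (a := e₀ * (4 : ℝ) ^ ((0 : ℤ) - 2))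
        (mul_pos he (zpow_pos (by norm_num) _)) fun t ht => gnShell_eq_zero_of_le (by norm_num) he ht
    exact hsq.comp ((h0.pow 2).add (hE.pow 2))
  -- the angular factors and the zone bump
  -- (the binary maps are composed in `uncurry` form and rewritten with `uncurry_apply_pair`, so
  -- that no definitional unfolding of `isoUFun`/`isoChartPoint` is ever attempted)
  have hu : ContDiff ℝ ((⊤ : ℕ∞) : WithTop ℕ∞)
      fun q : (ℝ × ℝ) × MomSpace => uncurry (isoUFun μ) ((q.1.1, q.2 1, q.2 2), q.1.2) :=
    (contDiff_uncurry_isoUFun hμ₁ hμ₂).comp hxs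
  simp only [uncurry_apply_pair] at hu
  have hk : ContDiff ℝ ((⊤ : ℕ∞) : WithTop ℕ∞)
      fun q : (ℝ × ℝ) × MomSpace => uncurry (isoChartPoint μ) ((q.1.1, q.2 1, q.2 2), q.1.2) :=
    (contDiff_uncurry_isoChartPoint hμ₁ hμ₂).comp hxs
  simp only [uncurry_apply_pair] at hk
  have h2r : 0 < 2 * truncRadius μ := by linarith [truncRadius_pos hμ₁ (μ := μ)]
  have hψ : ContDiff ℝ ((⊤ : ℕ∞) : WithTop ℕ∞) fun q : (ℝ × ℝ) × MomSpace =>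
      truncOne (2 * truncRadius μ) (Real.cos (3 * π / 4)) (Real.cos (7 * π / 8)) (isoUFun μ (q.1.1, q.2 1, q.2 2) q.1.2) :=
    (contDiff_truncOne (c₁ := Real.cos (3 * π / 4)) (c₂ := Real.cos (7 * π / 8)) h2r).comp hu
  have hW : ContDiff ℝ ((⊤ : ℕ∞) : WithTop ℕ∞)
      fun q : (ℝ × ℝ) × MomSpace => sectorUnitWeight (isoRescaledAngle μ ((q.1.1, q.2 1, q.2 2), q.1.2) / π) :=
    contDiff_sectorUnitWeight.comp (((contDiff_isoRescaledAngle hμ₁ hμ₂).comp hxs).div_const _)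
  have hχ : ContDiff ℝ ((⊤ : ℕ∞) : WithTop ℕ∞)
      fun q : (ℝ × ℝ) × MomSpace => zoneBump (isoChartPoint μ (q.1.1, q.2 1, q.2 2) q.1.2) :=
    contDiff_zoneBump.comp hk
  -- the inverse factor `conj(D̃) η(|D̃|²)`
  have hnSq : ContDiff ℝ ((⊤ : ℕ∞) : WithTop ℕ∞) fun q : (ℝ × ℝ) × MomSpace =>
      Complex.normSq (isoRescaledDenom μ (q.1.1, q.2 1, q.2 2) (q.2 0) q.1.2) := by
    have hfun : (fun q : (ℝ × ℝ) × MomSpace => Complex.normSq (isoRescaledDenom μ (q.1.1, q.2 1, q.2 2) (q.2 0) q.1.2)) =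
        fun q => ‖isoRescaledDenom μ (q.1.1, q.2 1, q.2 2) (q.2 0) q.1.2‖ ^ 2 := by
      funext q; exact Complex.normSq_eq_norm_sq _
    rw [hfun]
    exact hD.norm_sq ℝ
  have hη : ContDiff ℝ ((⊤ : ℕ∞) : WithTop ℕ∞) fun q : (ℝ × ℝ) × MomSpace =>
      sectorInvCutoff ((e₀ / 16) ^ 2) (Complex.normSq (isoRescaledDenom μ (q.1.1, q.2 1, q.2 2) (q.2 0) q.1.2)) :=
    (contDiff_sectorInvCutoff (q₀ := (e₀ / 16) ^ 2) (by positivity)).comp hnSq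
  have hconj : ContDiff ℝ ((⊤ : ℕ∞) : WithTop ℕ∞)
      fun q : (ℝ × ℝ) × MomSpace => conj (isoRescaledDenom μ (q.1.1, q.2 1, q.2 2) (q.2 0) q.1.2) :=
    Complex.conjCLE.contDiff.comp hD
  have hreal := ((hG.mul hψ).mul hW).mul hχ
  have hcplx := hconj.mul (Complex.ofRealCLM.contDiff.comp hη)
  have hfin := (Complex.ofRealCLM.contDiff.comp hreal).mul hcplx
  have key : isoMasterLift μ e₀ = fun q : (ℝ × ℝ) × MomSpace =>
      ((gnShell 4 e₀ 0 (Real.sqrt (q.2 0 ^ 2 + isoRescaledDispersion μ ((q.1.1, q.2 1, q.2 2), q.1.2) ^ 2)) *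
        truncOne (2 * truncRadius μ) (Real.cos (3 * π / 4)) (Real.cos (7 * π / 8)) (isoUFun μ (q.1.1, q.2 1, q.2 2) q.1.2) *
        sectorUnitWeight (isoRescaledAngle μ ((q.1.1, q.2 1, q.2 2), q.1.2) / π) *
        zoneBump (isoChartPoint μ (q.1.1, q.2 1, q.2 2) q.1.2) : ℝ) : ℂ) *
      (conj (isoRescaledDenom μ (q.1.1, q.2 1, q.2 2) (q.2 0) q.1.2) *
        (sectorInvCutoff ((e₀ / 16) ^ 2) (Complex.normSq (isoRescaledDenom μ (q.1.1, q.2 1, q.2 2) (q.2 0) q.1.2)) : ℂ)) := by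
    funext q; rfl
  rw [key]
  exact hfin

/-- **`rescaledIsoSymbol = 4ⁿ • Φ̄((θ̄_{n,ω̄}, 4^{-n}), ·)`.** [cite: BenfattoGiulianiMastropietro2006, §2.5 Lemma 2.3] -/
theorem rescaledIsoSymbol_eq_smul_isoMasterLift {e₀ : ℝ} (he : 0 < e₀) (he' : e₀ ≤ (4 + μ) / 2) (n : ℕ) (ω : ℤ) :
    rescaledIsoSymbol hμ₁ hμ₂ e₀ n ω = fun t =>
      (((4 : ℝ) ^ n : ℝ) : ℂ) • isoMasterLift μ e₀ ((((ω : ℝ) + 1 / 2) * sectorWidth (2 * n), (4 : ℝ) ^ (-(n : ℤ))), t) := by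
  funext t
  rw [rescaledIsoSymbol_eq_isoMasterSymbol hμ₁ hμ₂ he he' n ω t, smul_eq_mul]
  rfl

end Smooth

/-! ### The support box in rescaled coordinates -/

/-- `C̄₁ = C_r e₀ + C_n (9/16)π²` (so that `isoNormalExtent n ≤ C̄₁ 4^{-n}`). [cite: BenfattoGiulianiMastropietro2006, §2.5 (2.58)] -/
def isoNormalConst (μ e₀ : ℝ) : ℝ :=
  π / (4 * Real.sqrt ((4 + μ) / 2)) * e₀ +
    2 * accelBound μ * Real.sqrt (π ^ 2 / 8 + (4 * π ^ 3 / (μ + 4)) ^ 2) / Real.sqrt (μ + 4) * (9 / 16 * π ^ 2)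

/-- `C̄₂ = C_r e₀ + C_t (3/4)π` (so that `isoTangentExtent n = C̄₂ 4^{-n}`). [cite: BenfattoGiulianiMastropietro2006, §2.5 (2.58)] -/
def isoTangentConst (μ e₀ : ℝ) : ℝ :=
  π / (4 * Real.sqrt ((4 + μ) / 2)) * e₀ + 2 * Real.sqrt (π ^ 2 / 8 + (4 * π ^ 3 / (μ + 4)) ^ 2) * (3 / 4 * π)

section Box

variable {μ : ℝ} (hμ₁ : -4 < μ) (hμ₂ : μ < -2 - Real.sqrt 2)
include hμ₁ hμ₂

/-- **The support box in rescaled coordinates**: if `rescaledIsoSymbol e₀ n ω̄ (t) ≠ 0` then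
`|t₀| ≤ e₀`, `|t₁| ≤ C̄₁`, `|t₂| ≤ C̄₂`. [cite: BenfattoGiulianiMastropietro2006, §2.5 (2.58)] -/
theorem abs_le_of_rescaledIsoSymbol_ne_zero {e₀ : ℝ} (he : 0 < e₀) (he' : e₀ ≤ (4 + μ) / 2) {n : ℕ} {ω : ℤ}
    {t : MomSpace} (h : rescaledIsoSymbol hμ₁ hμ₂ e₀ n ω t ≠ 0) :
    |t 0| ≤ e₀ ∧ |t 1| ≤ isoNormalConst μ e₀ ∧ |t 2| ≤ isoTangentConst μ e₀ := by
  set θ₀ : ℝ := ((ω : ℝ) + 1 / 2) * sectorWidth (2 * n) with hθ₀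
  have h4pos : 0 < (4 : ℝ) ^ (-(n : ℤ)) := zpow_pos (by norm_num) _
  have hsplit := splitMomentum_fermiBasePoint_add_isoChart hμ₁ hμ₂ θ₀ n t
  have hS : genSymbol e₀ μ n (2 * n) ω ((4 : ℝ) ^ (-(n : ℤ)) * t 0,
      isoChartPoint μ (θ₀, t 1, t 2) ((4 : ℝ) ^ (-(n : ℤ)))) ≠ 0 := by
    intro h0; apply h
    change genSymbol e₀ μ n (2 * n) ω (splitMomentum (fermiBasePoint μ θ₀ + isoChart hμ₁ hμ₂ θ₀ n t)) = 0
    rw [hsplit]; exact h0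
  obtain ⟨h1, h2, h3⟩ := genSymbol_ne_zero hμ₁ hμ₂ he he' hS
  have hnc := normalCoord_isoChartPoint hμ₁ hμ₂ (θ₀, t 1, t 2) ((4 : ℝ) ^ (-(n : ℤ)))
  have htc := tangentCoord_isoChartPoint hμ₁ hμ₂ (θ₀, t 1, t 2) ((4 : ℝ) ^ (-(n : ℤ)))
  simp only at hnc htc
  rw [hnc] at h2; rw [htc] at h3
  obtain ⟨hB₁, hB₂⟩ := isoExtent_le hμ₁ n (μ := μ) (e₀ := e₀)
  obtain ⟨-, -, hE1, hE2⟩ := genExtent_eq μ e₀ n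
  rw [hE1] at h2; rw [hE2] at h3
  refine ⟨?_, ?_, ?_⟩
  · have h0 : |(4 : ℝ) ^ (-(n : ℤ)) * t 0| ≤ (4 : ℝ) ^ (-(n : ℤ)) * e₀ := by
      rw [mul_comm ((4 : ℝ) ^ (-(n : ℤ))) e₀]; exact abs_le.2 ⟨by linarith [h1.1], h1.2⟩
    rw [abs_mul, abs_of_pos h4pos] at h0
    exact le_of_mul_le_mul_left h0 h4pos
  · have h2' := h2.trans hB₁
    rw [abs_mul, abs_of_pos h4pos] at h2'
    change |t 1| ≤ isoNormalConst μ e₀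
    have : isoNormalConst μ e₀ = π / (4 * Real.sqrt ((4 + μ) / 2)) * e₀ +
        2 * accelBound μ * Real.sqrt (π ^ 2 / 8 + (4 * π ^ 3 / (μ + 4)) ^ 2) / Real.sqrt (μ + 4) * (9 / 16 * π ^ 2) := rfl
    rw [this]
    rw [mul_comm] at h2'
    exact le_of_mul_le_mul_right h2' h4pos
  · have h3' := h3.trans (le_of_eq hB₂)
    rw [abs_mul, abs_of_pos h4pos] at h3'
    change |t 2| ≤ isoTangentConst μ e₀
    have : isoTangentConst μ e₀ =
        π / (4 * Real.sqrt ((4 + μ) / 2)) * e₀ + 2 * Real.sqrt (π ^ 2 / 8 + (4 * π ^ 3 / (μ + 4)) ^ 2) * (3 / 4 * π) := rfl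
    rw [this]
    rw [mul_comm] at h3'
    exact le_of_mul_le_mul_right h3' h4pos

end Box

/-! ### `h`-uniform derivative bounds by compactness -/

section Uniform

variable {μ : ℝ} (hμ₁ : -4 < μ) (hμ₂ : μ < -2 - Real.sqrt 2)
include hμ₁ hμ₂

/-- **`h`-uniform derivative bounds of the rescaled isotropic symbols** (BGM 2006, Lemma 2.3 via
"a repetition of the proof of Lemma 2.2"): for `0 < e₀ ≤ (4+μ)/2` and every order `m` there is
`B ≥ 0` with `‖D^m(rescaledIsoSymbol e₀ n ω̄)(t)‖ ≤ 4ⁿ B` for all `n`, all sectors `0 ≤ ω̄ < 2·4ⁿ`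
and all `t`. [cite: BenfattoGiulianiMastropietro2006, §2.5 Lemma 2.3] -/
theorem exists_norm_iteratedFDeriv_rescaledIsoSymbol_le {e₀ : ℝ} (he : 0 < e₀) (he' : e₀ ≤ (4 + μ) / 2) (m : ℕ) :
    ∃ B : ℝ, 0 ≤ B ∧ ∀ (n : ℕ) (ω : ℕ), ω < sectorCount (2 * n) → ∀ t : MomSpace,
      ‖iteratedFDeriv ℝ m (rescaledIsoSymbol hμ₁ hμ₂ e₀ n ω) t‖ ≤ (4 : ℝ) ^ n * B := by
  -- the compact parameter × box set and a bound of the full derivative on it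
  set P : Set (ℝ × ℝ) := Icc 0 (2 * π) ×ˢ Icc 0 1 with hP
  set T : Set MomSpace := {t | |t 0| ≤ e₀ ∧ |t 1| ≤ isoNormalConst μ e₀ ∧ |t 2| ≤ isoTangentConst μ e₀} with hT
  have hK : IsCompact (P ×ˢ T) := (isCompact_Icc.prod isCompact_Icc).prod (isCompact_momBox _ _ _)
  have hF := contDiff_isoMasterLift hμ₁ hμ₂ he (μ := μ)
  have hcont : ContinuousOn (fun q : (ℝ × ℝ) × MomSpace => iteratedFDeriv ℝ m (isoMasterLift μ e₀) q) (P ×ˢ T) :=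
    (hF.continuous_iteratedFDeriv (WithTop.coe_le_coe.2 (le_top : (m : ℕ∞) ≤ ⊤))).continuousOn
  obtain ⟨B, hB⟩ := hK.exists_bound_of_continuousOn hcont
  refine ⟨max B 0, le_max_right _ _, fun n ω hω t => ?_⟩
  set θ₀ : ℝ := ((ω : ℝ) + 1 / 2) * sectorWidth (2 * n) with hθ₀
  set s : ℝ := (4 : ℝ) ^ (-(n : ℤ)) with hs
  have h4n : 0 < (4 : ℝ) ^ n := by positivity
  -- the parameters lie in `P`
  have hp : ((θ₀, s) : ℝ × ℝ) ∈ P := by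
    have hw := sectorWidth_pos (2 * n)
    have hN := sectorCount_mul_sectorWidth (2 * n)
    have hω' : (ω : ℝ) + 1 ≤ sectorCount (2 * n) := by exact_mod_cast hω
    refine ⟨⟨by positivity, ?_⟩, ⟨(zpow_pos (by norm_num) _).le, zpow_le_one_of_nonpos₀ (by norm_num) (by simp)⟩⟩
    calc ((ω : ℝ) + 1 / 2) * sectorWidth (2 * n) ≤ (sectorCount (2 * n) : ℝ) * sectorWidth (2 * n) :=
          mul_le_mul_of_nonneg_right (by linarith) hw.le
      _ = 2 * π := hN
  -- the symbol is `4ⁿ •` the slice of the master lift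
  have heq : rescaledIsoSymbol hμ₁ hμ₂ e₀ n ω = fun t => (((4 : ℝ) ^ n : ℝ) : ℂ) • isoMasterLift μ e₀ ((θ₀, s), t) := by
    have := rescaledIsoSymbol_eq_smul_isoMasterLift hμ₁ hμ₂ he he' n (ω : ℤ)
    rw [Int.cast_natCast] at this
    exact this
  have hslice : ContDiff ℝ ((⊤ : ℕ∞) : WithTop ℕ∞) fun t : MomSpace => isoMasterLift μ e₀ ((θ₀, s), t) :=
    hF.comp (contDiff_const.prodMk contDiff_id)
  have hder : iteratedFDeriv ℝ m (rescaledIsoSymbol hμ₁ hμ₂ e₀ n ω) t =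
      (((4 : ℝ) ^ n : ℝ) : ℂ) • iteratedFDeriv ℝ m (fun t : MomSpace => isoMasterLift μ e₀ ((θ₀, s), t)) t := by
    rw [heq]
    exact iteratedFDeriv_const_smul_apply' ((hslice.of_le (WithTop.coe_le_coe.2 (le_top : (m : ℕ∞) ≤ ⊤))).contDiffAt)
  by_cases ht : t ∈ T
  · -- on the box: the compactness bound
    rw [hder, norm_smul, Complex.norm_real, Real.norm_eq_abs, abs_of_pos h4n]
    refine mul_le_mul_of_nonneg_left ?_ h4n.le
    exact ((norm_iteratedFDeriv_slice_le hF (θ₀, s) m t).trans (hB _ (mk_mem_prod hp ht))).trans (le_max_left _ _)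
  · -- off the box: the symbol vanishes identically near `t`
    have hsupp : tsupport (rescaledIsoSymbol hμ₁ hμ₂ e₀ n ω) ⊆ T := by
      refine closure_minimal (fun u hu => ?_) (isCompact_momBox _ _ _).isClosed
      exact abs_le_of_rescaledIsoSymbol_ne_zero hμ₁ hμ₂ he he' hu
    have h0 : iteratedFDeriv ℝ m (rescaledIsoSymbol hμ₁ hμ₂ e₀ n ω) t = 0 := by
      by_contra hne
      exact ht (hsupp (support_iteratedFDeriv_subset m (Function.mem_support.2 hne)))
    rw [h0, norm_zero]
    positivity

end Uniform

end Literature.MathematicalPhysics.QuantumLattice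

end
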